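import Mathlib.Analysis.Calculus.SmoothSeries
import Mathlib.Analysis.Calculus.BumpFunction.FiniteDimension
import Mathlib.Analysis.Calculus.IteratedDeriv.Lemmas
import Mathlib.Analysis.Calculus.ContDiff.Bounds
import Mathlib.Analysis.Normed.Operator.Prod
import Mathlib.Topology.Algebra.InfiniteSum.Real
import HarnessLib

/-!
# Borel's lemma by cut-off power series: `∑ₖ sᵏ/k! · χ(s/εₖ) · bₖ`

Topic `Analysis/Calculus`. É. Borel's theorem (every sequence is the sequence of derivatives at
`0` of a `C^∞` function; Hörmander, *The Analysis of Linear Partial Differential Operators I*,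
Thm. 1.2.6) in the explicit cut-off form and **with parameters**: for coefficients `bₖ` the series

  `W(s) = ∑ₖ (sᵏ / k!) χ(s / εₖ) bₖ`,   `χ = 1` near `0`, `χ = 0` off `[-2, 2]`,

converges with all derivatives as soon as the scales `εₖ ↓ 0` fast enough relative to the size of
the `bₖ` (and of finitely many of their derivatives, when the `bₖ` depend on parameters), and then
`W^{(j)}(0) = bⱼ`. We prove:

* `cutoffMonomial k ε s = sᵏ/k! · χ(s/ε)` (`χ` a fixed bump, Mathlib's `ContDiffBump`): smooth,
  `= sᵏ/k!` for `|s| ≤ ε`, `= 0` for `|s| ≥ 2ε`, derivatives at `0` are `δⱼₖ`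
  (`iteratedDeriv_cutoffMonomial_zero`), and the **scaling bound**
  `‖(cutoffMonomial k ε)^{(l)}‖_∞ ≤ ε · Cₖ` for `l < k`, `0 < ε ≤ 1` (`norm_iteratedDeriv_cutoffMonomial_le`);
* `contDiff_tsum_cutoffMonomial_mul`, `iteratedDeriv_tsum_cutoffMonomial_mul_zero` — **the
  one-variable master lemma**: for smooth `gₖ : ℝ → ℝ` with `|gₖ^{(j)}| ≤ Lₖⱼ` on `[-1, 1]` and
  scales with `εₖ Cₖ ∑_{j ≤ k} Lₖⱼ ≤ 4⁻ᵏ`, the series `G(s) = ∑ₖ cutoffMonomial k εₖ (s) gₖ(s)` is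
  `C^∞` and `G^{(j)}(0) = ∑_{k ≤ j} (j choose k) gₖ^{(j-k)}(0)` (Leibniz, Mathlib's
  `iteratedDeriv_mul`; termwise differentiation, Mathlib's `iteratedFDeriv_tsum_apply`);
* `contDiff_tsum_cutoffMonomial_mul_param` — **parameters**: for smooth `bₖ : E → ℝ` with
  `‖Dⁱ bₖ‖ ≤ Sₖᵢ` and `εₖ Cₖ ∑_{i ≤ k} Sₖᵢ ≤ 4⁻ᵏ`, `(y, s) ↦ ∑ₖ cutoffMonomial k εₖ (s) bₖ(y)` is
  `C^∞` on `E × ℝ` (Mathlib's `contDiff_tsum_of_eventually`);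
* `exists_borel_extension` — **Borel's lemma with parameters**: for smooth compactly supported
  `bₖ : E → ℝ` (`E` finite-dimensional) and any prescribed bounds `δₖ > 0` there are scales
  `0 < εₖ ≤ δₖ` such that `W(y, s) = ∑ₖ cutoffMonomial k εₖ (s) bₖ(y)` is `C^∞` on `E × ℝ` and
  `∂ₛʲ W(y, 0) = bⱼ(y)` for all `j`, `y`. The freedom `εₖ ≤ δₖ` lets a consumer make further
  series built from the same cut-offs converge (e.g. the action of a differential operator on `W`).

Everything is proved; the only definitions are `cutoffMonomial` and the auxiliary profile and
constants (`cutoffProfile`, `cutoffProfileBound`, `cutoffConst`), each with unfolding lemmas.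

## References

* L. Hörmander, *The Analysis of Linear Partial Differential Operators I*, 2nd ed., Springer
  1990, Thm. 1.2.6 (Borel's theorem, proof by cut-off series). [folklore]
-/

noncomputable section

open Set Function Filter Metric Finset
open scoped Topology ContDiff Nat

namespace Literature.Analysis.Calculus

/-! ### The cut-off and the cut-off monomials -/

/-- A fixed smooth bump on `ℝ`: `= 1` on `[-1, 1]`, supported in `(-2, 2)`, values in `[0, 1]`
(Mathlib's `ContDiffBump` centred at `0` with radii `1 < 2`). [folklore] -/
def cutoffBump : ContDiffBump (0 : ℝ) := ⟨1, 2, one_pos, one_lt_two⟩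

/-- The inner radius of the fixed bump. [folklore] -/
@[simp] theorem cutoffBump_rIn : cutoffBump.rIn = 1 := rfl

/-- The outer radius of the fixed bump. [folklore] -/
@[simp] theorem cutoffBump_rOut : cutoffBump.rOut = 2 := rfl

/-- `χ = 1` on `[-1, 1]`. [folklore] -/
theorem cutoffBump_eq_one {σ : ℝ} (h : |σ| ≤ 1) : (cutoffBump : ℝ → ℝ) σ = 1 :=
  cutoffBump.one_of_mem_closedBall (by simpa [Real.dist_eq] using h)

/-- `χ = 0` off `(-2, 2)`. [folklore] -/
theorem cutoffBump_eq_zero {σ : ℝ} (h : 2 ≤ |σ|) : (cutoffBump : ℝ → ℝ) σ = 0 :=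
  cutoffBump.zero_of_le_dist (by simpa [Real.dist_eq] using h)

/-- The profile `Ψₖ(σ) = σᵏ/k! · χ(σ)` (the cut-off monomial at scale `1`). [folklore] -/
def cutoffProfile (k : ℕ) (σ : ℝ) : ℝ := σ ^ k / k ! * (cutoffBump : ℝ → ℝ) σ

/-- Unfolding `cutoffProfile`. [folklore] -/
theorem cutoffProfile_apply (k : ℕ) (σ : ℝ) :
    cutoffProfile k σ = σ ^ k / k ! * (cutoffBump : ℝ → ℝ) σ := rfl

/-- The profiles are smooth. [folklore] -/
theorem contDiff_cutoffProfile (k : ℕ) : ContDiff ℝ ∞ (cutoffProfile k) :=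
  ((contDiff_id.pow k).div_const _).mul cutoffBump.contDiff

/-- The profiles are supported in `[-2, 2]`. [folklore] -/
theorem cutoffProfile_eq_zero {k : ℕ} {σ : ℝ} (h : 2 ≤ |σ|) : cutoffProfile k σ = 0 := by
  simp [cutoffProfile_apply, cutoffBump_eq_zero h]

/-- The profiles have compact support. [folklore] -/
theorem hasCompactSupport_cutoffProfile (k : ℕ) : HasCompactSupport (cutoffProfile k) := by
  refine HasCompactSupport.of_support_subset_isCompact (isCompact_Icc (a := -2) (b := 2)) ?_
  intro σ hσ
  by_contra hσ'
  simp only [Set.mem_Icc, not_and_or, not_le] at hσ'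
  refine hσ (cutoffProfile_eq_zero ?_)
  rcases hσ' with h | h
  · rw [abs_of_neg (by linarith)]; linarith
  · rw [abs_of_pos (by linarith)]; linarith

/-- **The derivatives of the profiles are bounded**: `‖Ψₖ^{(l)}‖_∞ < ∞` (smooth with compact
support). The bound is recorded as the constant `cutoffProfileBound k l`. [folklore] -/
theorem exists_norm_iteratedDeriv_cutoffProfile_le (k l : ℕ) :
    ∃ C : ℝ, 0 ≤ C ∧ ∀ σ, ‖iteratedDeriv l (cutoffProfile k) σ‖ ≤ C := by
  have hc : Continuous (iteratedDeriv l (cutoffProfile k)) :=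
    (contDiff_cutoffProfile k).continuous_iteratedDeriv l (by exact_mod_cast le_top)
  have hs : HasCompactSupport (iteratedDeriv l (cutoffProfile k)) := by
    refine ((hasCompactSupport_cutoffProfile k).iteratedFDeriv (𝕜 := ℝ) l).mono ?_
    intro σ hσ
    rw [mem_support, iteratedDeriv_eq_iteratedFDeriv] at hσ
    rw [mem_support]
    intro h0
    exact hσ (by rw [h0]; rfl)
  obtain ⟨C, hC⟩ := hc.bounded_above_of_compact_support hs
  exact ⟨max C 0, le_max_right _ _, fun σ ↦ (hC σ).trans (le_max_left _ _)⟩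

/-- `sup_σ ‖Ψₖ^{(l)}(σ)‖`, a bound for the `l`-th derivative of the `k`-th profile. [folklore] -/
def cutoffProfileBound (k l : ℕ) : ℝ := (exists_norm_iteratedDeriv_cutoffProfile_le k l).choose

/-- The recorded bounds are nonnegative. [folklore] -/
theorem cutoffProfileBound_nonneg (k l : ℕ) : 0 ≤ cutoffProfileBound k l :=
  (exists_norm_iteratedDeriv_cutoffProfile_le k l).choose_spec.1

/-- `‖Ψₖ^{(l)}(σ)‖ ≤ cutoffProfileBound k l`. [folklore] -/
theorem norm_iteratedDeriv_cutoffProfile_le (k l : ℕ) (σ : ℝ) :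
    ‖iteratedDeriv l (cutoffProfile k) σ‖ ≤ cutoffProfileBound k l :=
  (exists_norm_iteratedDeriv_cutoffProfile_le k l).choose_spec.2 σ

/-- The constant `Cₖ = ∑_{l ≤ k} sup ‖Ψₖ^{(l)}‖` of the scaling bound. [folklore] -/
def cutoffConst (k : ℕ) : ℝ := ∑ l ∈ range (k + 1), cutoffProfileBound k l

/-- `Cₖ ≥ 0`. [folklore] -/
theorem cutoffConst_nonneg (k : ℕ) : 0 ≤ cutoffConst k :=
  sum_nonneg fun l _ ↦ cutoffProfileBound_nonneg k l

/-- Each bound of order `l ≤ k` is dominated by `Cₖ`. [folklore] -/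
theorem cutoffProfileBound_le_cutoffConst {k l : ℕ} (hl : l ≤ k) :
    cutoffProfileBound k l ≤ cutoffConst k :=
  single_le_sum (f := fun l ↦ cutoffProfileBound k l) (fun l _ ↦ cutoffProfileBound_nonneg k l)
    (Finset.mem_range.2 (Nat.lt_succ_of_le hl))

/-- **The cut-off monomial** `sᵏ/k! · χ(s/ε)` at scale `ε`. [folklore] -/
def cutoffMonomial (k : ℕ) (ε : ℝ) (s : ℝ) : ℝ := s ^ k / k ! * (cutoffBump : ℝ → ℝ) (s / ε)

/-- Unfolding `cutoffMonomial`. [folklore] -/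
theorem cutoffMonomial_apply (k : ℕ) (ε s : ℝ) :
    cutoffMonomial k ε s = s ^ k / k ! * (cutoffBump : ℝ → ℝ) (s / ε) := rfl

/-- Scaling: `cutoffMonomial k ε s = εᵏ Ψₖ(s/ε)` (`ε ≠ 0`). [folklore] -/
theorem cutoffMonomial_eq_scale {k : ℕ} {ε : ℝ} (hε : ε ≠ 0) (s : ℝ) :
    cutoffMonomial k ε s = ε ^ k * cutoffProfile k (ε⁻¹ * s) := by
  rw [cutoffMonomial_apply, cutoffProfile_apply, div_eq_inv_mul s ε, mul_pow, inv_pow]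
  field_simp

/-- The cut-off monomials are smooth. [folklore] -/
theorem contDiff_cutoffMonomial (k : ℕ) (ε : ℝ) : ContDiff ℝ ∞ (cutoffMonomial k ε) :=
  ((contDiff_id.pow k).div_const _).mul (cutoffBump.contDiff.comp (contDiff_id.div_const _))

/-- `cutoffMonomial k ε s = sᵏ/k!` for `|s| ≤ ε` (`ε > 0`). [folklore] -/
theorem cutoffMonomial_eq_of_abs_le {k : ℕ} {ε s : ℝ} (hε : 0 < ε) (h : |s| ≤ ε) :
    cutoffMonomial k ε s = s ^ k / k ! := by
  rw [cutoffMonomial_apply, cutoffBump_eq_one, mul_one]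
  rw [abs_div, abs_of_pos hε, div_le_one hε]
  exact h

/-- Near `0` the cut-off monomial is the monomial. [folklore] -/
theorem cutoffMonomial_eventuallyEq {k : ℕ} {ε : ℝ} (hε : 0 < ε) :
    cutoffMonomial k ε =ᶠ[𝓝 0] fun s ↦ s ^ k / k ! := by
  filter_upwards [Metric.closedBall_mem_nhds (0 : ℝ) hε] with s hs
  exact cutoffMonomial_eq_of_abs_le hε (by simpa [Real.dist_eq] using hs)

/-- `cutoffMonomial k ε s = 0` for `|s| ≥ 2ε` (`ε > 0`). [folklore] -/
theorem cutoffMonomial_eq_zero {k : ℕ} {ε s : ℝ} (hε : 0 < ε) (h : 2 * ε ≤ |s|) :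
    cutoffMonomial k ε s = 0 := by
  rw [cutoffMonomial_apply, cutoffBump_eq_zero, mul_zero]
  rw [abs_div, abs_of_pos hε, le_div_iff₀ hε]
  exact h

/-- The cut-off monomial vanishes near every `s` with `|s| > 2ε`, together with all its
derivatives. [folklore] -/
theorem iteratedDeriv_cutoffMonomial_eq_zero {k : ℕ} {ε s : ℝ} (hε : 0 < ε) (h : 2 * ε < |s|)
    (l : ℕ) : iteratedDeriv l (cutoffMonomial k ε) s = 0 := by
  have hev : cutoffMonomial k ε =ᶠ[𝓝 s] fun _ ↦ (0 : ℝ) := by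
    have hopen : IsOpen {s : ℝ | 2 * ε < |s|} := isOpen_lt continuous_const continuous_abs
    filter_upwards [hopen.mem_nhds h] with r hr
    exact cutoffMonomial_eq_zero hε hr.le
  rw [hev.iteratedDeriv_eq l, iteratedDeriv_const]
  simp

/-- **Derivatives at `0`**: `(cutoffMonomial k ε)^{(j)}(0) = δⱼₖ` (`ε > 0`). [folklore] -/
theorem iteratedDeriv_cutoffMonomial_zero {k : ℕ} {ε : ℝ} (hε : 0 < ε) (j : ℕ) :
    iteratedDeriv j (cutoffMonomial k ε) 0 = if j = k then 1 else 0 := by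
  rw [(cutoffMonomial_eventuallyEq (k := k) hε).iteratedDeriv_eq j]
  have h1 : (fun s : ℝ ↦ s ^ k / k !) = fun s ↦ ((k ! : ℝ)⁻¹) * s ^ k := by
    funext s; rw [div_eq_inv_mul]
  rw [h1, iteratedDeriv_const_mul _ (by fun_prop), iteratedDeriv_fun_pow_zero]
  split_ifs with h
  · field_simp
  · simp

/-- **The scaling bound**: `‖(cutoffMonomial k ε)^{(l)}(s)‖ ≤ ε^{k-l} sup ‖Ψₖ^{(l)}‖` for
`l ≤ k`, `ε > 0`. [folklore] -/
theorem norm_iteratedDeriv_cutoffMonomial_le' {k l : ℕ} (hl : l ≤ k) {ε : ℝ} (hε : 0 < ε) (s : ℝ) :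
    ‖iteratedDeriv l (cutoffMonomial k ε) s‖ ≤ ε ^ (k - l) * cutoffProfileBound k l := by
  have hfun : cutoffMonomial k ε = fun s ↦ ε ^ k * cutoffProfile k (ε⁻¹ * s) := by
    funext s; exact cutoffMonomial_eq_scale hε.ne' s
  have hl' : (l : WithTop ℕ∞) ≤ ∞ := by exact_mod_cast (le_top : (l : ℕ∞) ≤ ⊤)
  rw [hfun, iteratedDeriv_const_mul _ (by
    exact ((contDiff_cutoffProfile k).comp (contDiff_const.mul contDiff_id)).contDiffAt.of_le hl')]
  have hcomp := iteratedDeriv_comp_const_mul ((contDiff_cutoffProfile k).of_le hl') ε⁻¹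
  rw [show (fun s ↦ cutoffProfile k (ε⁻¹ * s)) = fun x ↦ cutoffProfile k (ε⁻¹ * x) from rfl, hcomp]
  simp only [norm_mul, norm_pow, Real.norm_eq_abs, abs_of_pos hε, abs_inv]
  calc ε ^ k * (ε⁻¹ ^ l * |iteratedDeriv l (cutoffProfile k) (ε⁻¹ * s)|)
      = ε ^ (k - l) * |iteratedDeriv l (cutoffProfile k) (ε⁻¹ * s)| := by
        rw [← mul_assoc]
        congr 1
        rw [pow_sub₀ _ hε.ne' hl, inv_pow]
    _ ≤ ε ^ (k - l) * cutoffProfileBound k l := by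
        gcongr
        exact (Real.norm_eq_abs _).symm.le.trans (norm_iteratedDeriv_cutoffProfile_le k l _)

/-- **The scaling bound, uniform form**: for `l < k` and `0 < ε ≤ 1`,
`‖(cutoffMonomial k ε)^{(l)}(s)‖ ≤ ε · Cₖ`. [folklore] -/
theorem norm_iteratedDeriv_cutoffMonomial_le {k l : ℕ} (hl : l < k) {ε : ℝ} (hε : 0 < ε)
    (hε1 : ε ≤ 1) (s : ℝ) : ‖iteratedDeriv l (cutoffMonomial k ε) s‖ ≤ ε * cutoffConst k := by
  refine (norm_iteratedDeriv_cutoffMonomial_le' hl.le hε s).trans ?_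
  have h1 : ε ^ (k - l) ≤ ε := by
    obtain ⟨d, hd⟩ : ∃ d, k - l = d + 1 := ⟨k - l - 1, by omega⟩
    rw [hd, pow_succ]
    exact mul_le_of_le_one_left hε.le (pow_le_one₀ hε.le hε1)
  exact mul_le_mul h1 (cutoffProfileBound_le_cutoffConst hl.le) (cutoffProfileBound_nonneg _ _)
    hε.le

/-! ### Leibniz bounds for the terms of the series -/

/-- **Bound for the derivatives of a term `cutoffMonomial k ε · g`** (one variable): if `g` is
smooth with `‖g^{(i)}‖ ≤ L i` on `[-1, 1]`, `0 < ε ≤ 1/2` and `j < k`, then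
`‖(cutoffMonomial k ε · g)^{(j)}(s)‖ ≤ 2ʲ ε Cₖ ∑_{i ≤ j} L i` for every `s`. [folklore] -/
theorem norm_iteratedDeriv_cutoffMonomial_mul_le {k j : ℕ} (hj : j < k) {ε : ℝ} (hε : 0 < ε)
    (hε2 : ε ≤ 1 / 2) {g : ℝ → ℝ} (hg : ContDiff ℝ ∞ g) {L : ℕ → ℝ} (hL0 : ∀ i, 0 ≤ L i)
    (hL : ∀ i ≤ j, ∀ s ∈ Icc (-1 : ℝ) 1, ‖iteratedDeriv i g s‖ ≤ L i) (s : ℝ) :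
    ‖iteratedDeriv j (fun s ↦ cutoffMonomial k ε s * g s) s‖ ≤
      2 ^ j * (ε * cutoffConst k) * ∑ i ∈ range (j + 1), L i := by
  rcases le_or_gt (|s|) (2 * ε) with hs | hs
  · -- on the support: Leibniz
    have hs1 : s ∈ Icc (-1 : ℝ) 1 := by
      have : |s| ≤ 1 := hs.trans (by linarith)
      exact ⟨by linarith [neg_abs_le s], by linarith [le_abs_self s]⟩
    have hj' : (j : WithTop ℕ∞) ≤ ∞ := by exact_mod_cast (le_top : (j : ℕ∞) ≤ ⊤)
    have hleib := iteratedDeriv_mul (n := j) (x := s)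
      ((contDiff_cutoffMonomial k ε).contDiffAt.of_le hj') (hg.contDiffAt.of_le hj')
    rw [show (fun s ↦ cutoffMonomial k ε s * g s) = (cutoffMonomial k ε * g) from rfl, hleib]
    calc ‖∑ i ∈ range (j + 1), (j.choose i : ℝ) * iteratedDeriv i (cutoffMonomial k ε) s *
            iteratedDeriv (j - i) g s‖
        ≤ ∑ i ∈ range (j + 1), ‖(j.choose i : ℝ) * iteratedDeriv i (cutoffMonomial k ε) s *
            iteratedDeriv (j - i) g s‖ := norm_sum_le _ _
      _ ≤ ∑ i ∈ range (j + 1), (j.choose i : ℝ) * (ε * cutoffConst k) *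
            ∑ i' ∈ range (j + 1), L i' := by
          refine sum_le_sum fun i hi ↦ ?_
          have hij : i ≤ j := Nat.lt_succ_iff.1 (Finset.mem_range.1 hi)
          rw [norm_mul, norm_mul, Real.norm_natCast]
          refine mul_le_mul (mul_le_mul_of_nonneg_left
            (norm_iteratedDeriv_cutoffMonomial_le (hij.trans_lt hj) hε (by linarith) s)
            (Nat.cast_nonneg _)) ?_ (norm_nonneg _)
            (mul_nonneg (Nat.cast_nonneg _) (mul_nonneg hε.le (cutoffConst_nonneg k)))
          exact (hL (j - i) (Nat.sub_le j i) s hs1).trans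
            (single_le_sum (f := L) (fun i _ ↦ hL0 i)
              (Finset.mem_range.2 (Nat.lt_succ_of_le (Nat.sub_le j i))))
      _ = 2 ^ j * (ε * cutoffConst k) * ∑ i ∈ range (j + 1), L i := by
          rw [← sum_mul, ← sum_mul]
          have := (Nat.cast_inj (R := ℝ)).2 (Nat.sum_range_choose j)
          push_cast at this
          rw [this]
  · -- off the support everything vanishes
    have hev : (fun s ↦ cutoffMonomial k ε s * g s) =ᶠ[𝓝 s] fun _ ↦ (0 : ℝ) := by
      have hopen : IsOpen {s : ℝ | 2 * ε < |s|} := isOpen_lt continuous_const continuous_abs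
      filter_upwards [hopen.mem_nhds hs] with r hr
      rw [cutoffMonomial_eq_zero hε hr.le, zero_mul]
    rw [hev.iteratedDeriv_eq j, iteratedDeriv_const]
    simp only [ite_self, norm_zero]
    have := cutoffConst_nonneg k
    have : 0 ≤ ∑ i ∈ range (j + 1), L i := sum_nonneg fun i _ ↦ hL0 i
    positivity


/-! ### The one-variable master lemma -/

section OneVariable

variable {ε : ℕ → ℝ} {g : ℕ → ℝ → ℝ} {L : ℕ → ℕ → ℝ}

/-- The terms of the series have compact support, hence bounded derivatives of every order.
[folklore] -/
theorem exists_norm_iteratedFDeriv_term_le (hε : ∀ k, 0 < ε k) (hg : ∀ k, ContDiff ℝ ∞ (g k))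
    (k j : ℕ) : ∃ M : ℝ, ∀ s, ‖iteratedFDeriv ℝ j (fun s ↦ cutoffMonomial k (ε k) s * g k s) s‖ ≤ M := by
  have hsmooth : ContDiff ℝ ∞ (fun s ↦ cutoffMonomial k (ε k) s * g k s) :=
    (contDiff_cutoffMonomial k (ε k)).mul (hg k)
  have hsupp : HasCompactSupport (fun s ↦ cutoffMonomial k (ε k) s * g k s) := by
    refine HasCompactSupport.of_support_subset_isCompact
      (isCompact_Icc (a := -(2 * ε k)) (b := 2 * ε k)) fun s hs ↦ ?_
    by_contra hs'
    simp only [Set.mem_Icc, not_and_or, not_le] at hs'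
    refine hs ?_
    show cutoffMonomial k (ε k) s * g k s = 0
    rw [cutoffMonomial_eq_zero (hε k) ?_, zero_mul]
    rcases hs' with h | h
    · rw [abs_of_neg (by linarith [hε k])]; linarith
    · rw [abs_of_pos (by linarith [hε k])]; linarith
  exact ((hsmooth.continuous_iteratedFDeriv (by exact_mod_cast le_top)).bounded_above_of_compact_support
    (hsupp.iteratedFDeriv j))

/-- **Master lemma, smoothness.** Let `0 < εₖ ≤ 1/2`, `gₖ : ℝ → ℝ` smooth with
`‖gₖ^{(i)}‖ ≤ Lₖᵢ` on `[-1, 1]` (`Lₖᵢ ≥ 0`), and `εₖ Cₖ ∑_{i ≤ k} Lₖᵢ ≤ 4⁻ᵏ`. Then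
`s ↦ ∑ₖ cutoffMonomial k εₖ (s) gₖ(s)` is `C^∞`: for `j < k` the `j`-th derivative of the `k`-th
term is bounded by `2ʲ 4⁻ᵏ ≤ 2⁻ᵏ` (`norm_iteratedDeriv_cutoffMonomial_mul_le`), so Mathlib's
`contDiff_tsum_of_eventually` applies. [folklore] -/
theorem contDiff_tsum_cutoffMonomial_mul (hε : ∀ k, 0 < ε k) (hε2 : ∀ k, ε k ≤ 1 / 2)
    (hg : ∀ k, ContDiff ℝ ∞ (g k)) (hL0 : ∀ k i, 0 ≤ L k i)
    (hL : ∀ k i, ∀ s ∈ Icc (-1 : ℝ) 1, ‖iteratedDeriv i (g k) s‖ ≤ L k i)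
    (hdec : ∀ k, ε k * cutoffConst k * ∑ i ∈ range (k + 1), L k i ≤ (1 / 4) ^ k) :
    ContDiff ℝ ∞ (fun s ↦ ∑' k, cutoffMonomial k (ε k) s * g k s) := by
  refine contDiff_tsum_of_eventually (N := (⊤ : ℕ∞)) (v := fun _ k ↦ (1 / 2 : ℝ) ^ k)
    (fun k ↦ (contDiff_cutoffMonomial k (ε k)).mul (hg k))
    (fun j _ ↦ summable_geometric_of_lt_one (by norm_num) (by norm_num)) fun j _ ↦ ?_
  rw [eventually_cofinite]
  refine (finite_le_nat j).subset fun k hk ↦ ?_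
  by_contra hjk
  simp only [Set.mem_setOf_eq, not_le] at hjk
  refine hk fun s ↦ ?_
  rw [norm_iteratedFDeriv_eq_norm_iteratedDeriv]
  refine (norm_iteratedDeriv_cutoffMonomial_mul_le hjk (hε k) (hε2 k) (hg k) (hL0 k)
    (fun i _ s hs ↦ hL k i s hs) s).trans ?_
  -- `2ʲ (εₖ Cₖ ∑_{i ≤ j} Lₖᵢ) ≤ 2ʲ 4⁻ᵏ ≤ 2⁻ᵏ`
  have hsum : ∑ i ∈ range (j + 1), L k i ≤ ∑ i ∈ range (k + 1), L k i :=
    sum_le_sum_of_subset_of_nonneg (range_subset_range.2 (by omega)) fun i _ _ ↦ hL0 k i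
  have hC : 0 ≤ ε k * cutoffConst k := mul_nonneg (hε k).le (cutoffConst_nonneg k)
  calc 2 ^ j * (ε k * cutoffConst k) * ∑ i ∈ range (j + 1), L k i
      ≤ 2 ^ j * (ε k * cutoffConst k * ∑ i ∈ range (k + 1), L k i) := by
        rw [mul_assoc]; gcongr
    _ ≤ 2 ^ j * (1 / 4) ^ k := by gcongr; exact hdec k
    _ ≤ 2 ^ k * (1 / 4) ^ k :=
        mul_le_mul_of_nonneg_right (pow_le_pow_right₀ (by norm_num) hjk.le) (by positivity)
    _ = (1 / 2) ^ k := by rw [← mul_pow]; norm_num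

/-- The derivatives at `0` of the terms: `(cutoffMonomial k εₖ · gₖ)^{(j)}(0) = (j choose k) gₖ^{(j-k)}(0)`
for `k ≤ j` and `0` for `k > j` (Leibniz and `(cutoffMonomial k ε)^{(i)}(0) = δᵢₖ`).
[folklore] -/
theorem iteratedDeriv_cutoffMonomial_mul_zero (hε : ∀ k, 0 < ε k) (hg : ∀ k, ContDiff ℝ ∞ (g k))
    (k j : ℕ) :
    iteratedDeriv j (fun s ↦ cutoffMonomial k (ε k) s * g k s) 0 =
      if k ≤ j then (j.choose k : ℝ) * iteratedDeriv (j - k) (g k) 0 else 0 := by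
  have hj' : (j : WithTop ℕ∞) ≤ ∞ := by exact_mod_cast (le_top : (j : ℕ∞) ≤ ⊤)
  have hleib := iteratedDeriv_mul (n := j) (x := (0 : ℝ))
    ((contDiff_cutoffMonomial k (ε k)).contDiffAt.of_le hj') ((hg k).contDiffAt.of_le hj')
  rw [show (fun s ↦ cutoffMonomial k (ε k) s * g k s) = (cutoffMonomial k (ε k) * g k) from rfl,
    hleib]
  simp_rw [iteratedDeriv_cutoffMonomial_zero (hε k)]
  have h1 : ∀ i ∈ range (j + 1), (j.choose i : ℝ) * (if i = k then (1 : ℝ) else 0) *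
      iteratedDeriv (j - i) (g k) 0 =
      if i = k then (j.choose i : ℝ) * iteratedDeriv (j - i) (g k) 0 else 0 := by
    intro i _
    split_ifs <;> simp
  rw [sum_congr rfl h1, sum_ite_eq']
  simp only [Finset.mem_range, Nat.lt_succ_iff]

/-- **Master lemma, derivatives at `0`.** Under the hypotheses of
`contDiff_tsum_cutoffMonomial_mul`, for every `j`:
`(∑ₖ cutoffMonomial k εₖ gₖ)^{(j)}(0) = ∑_{k ≤ j} (j choose k) gₖ^{(j-k)}(0)` (termwise
differentiation, Mathlib's `iteratedFDeriv_tsum_apply`, and the previous lemma). [folklore] -/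
theorem iteratedDeriv_tsum_cutoffMonomial_mul_zero (hε : ∀ k, 0 < ε k) (hε2 : ∀ k, ε k ≤ 1 / 2)
    (hg : ∀ k, ContDiff ℝ ∞ (g k)) (hL0 : ∀ k i, 0 ≤ L k i)
    (hL : ∀ k i, ∀ s ∈ Icc (-1 : ℝ) 1, ‖iteratedDeriv i (g k) s‖ ≤ L k i)
    (hdec : ∀ k, ε k * cutoffConst k * ∑ i ∈ range (k + 1), L k i ≤ (1 / 4) ^ k) (j : ℕ) :
    iteratedDeriv j (fun s ↦ ∑' k, cutoffMonomial k (ε k) s * g k s) 0 =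
      ∑ k ∈ range (j + 1), (j.choose k : ℝ) * iteratedDeriv (j - k) (g k) 0 := by
  -- global bounds for ALL terms: the geometric bound beyond the order, any bound before it
  set f : ℕ → ℝ → ℝ := fun k s ↦ cutoffMonomial k (ε k) s * g k s with hf
  have hfs : ∀ k, ContDiff ℝ ∞ (f k) := fun k ↦ (contDiff_cutoffMonomial k (ε k)).mul (hg k)
  have hgeo : ∀ i k, i < k → ∀ s, ‖iteratedFDeriv ℝ i (f k) s‖ ≤ (1 / 2 : ℝ) ^ k := by
    intro i k hik s
    rw [norm_iteratedFDeriv_eq_norm_iteratedDeriv]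
    refine (norm_iteratedDeriv_cutoffMonomial_mul_le hik (hε k) (hε2 k) (hg k) (hL0 k)
      (fun i _ s hs ↦ hL k i s hs) s).trans ?_
    have hsum : ∑ i' ∈ range (i + 1), L k i' ≤ ∑ i' ∈ range (k + 1), L k i' :=
      sum_le_sum_of_subset_of_nonneg (range_subset_range.2 (by omega)) fun i _ _ ↦ hL0 k i
    have hC : 0 ≤ ε k * cutoffConst k := mul_nonneg (hε k).le (cutoffConst_nonneg k)
    calc 2 ^ i * (ε k * cutoffConst k) * ∑ i' ∈ range (i + 1), L k i'
        ≤ 2 ^ i * (ε k * cutoffConst k * ∑ i' ∈ range (k + 1), L k i') := by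
          rw [mul_assoc]; gcongr
      _ ≤ 2 ^ i * (1 / 4) ^ k := by gcongr; exact hdec k
      _ ≤ 2 ^ k * (1 / 4) ^ k :=
          mul_le_mul_of_nonneg_right (pow_le_pow_right₀ (by norm_num) hik.le) (by positivity)
      _ = (1 / 2) ^ k := by rw [← mul_pow]; norm_num
  choose M hM using fun k i ↦ exists_norm_iteratedFDeriv_term_le hε hg k i
  set v : ℕ → ℕ → ℝ := fun i k ↦ if i < k then (1 / 2 : ℝ) ^ k else M k i with hv
  have hvs : ∀ i : ℕ, ((i : ℕ∞) ≤ ⊤) → Summable (v i) := by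
    intro i _
    have hgeom : Summable fun k : ℕ ↦ (1 / 2 : ℝ) ^ k :=
      summable_geometric_of_lt_one (by norm_num) (by norm_num)
    have hdiff : Summable fun k : ℕ ↦ v i k - (1 / 2 : ℝ) ^ k := by
      refine summable_of_ne_finset_zero (s := range (i + 1)) fun k hk ↦ ?_
      have hik : i < k := by simpa [Finset.mem_range, Nat.lt_succ_iff, not_le] using hk
      simp [hv, hik]
    simpa using hdiff.add hgeom
  have hvb : ∀ (i : ℕ) (k : ℕ) (s : ℝ), ((i : ℕ∞) ≤ ⊤) → ‖iteratedFDeriv ℝ i (f k) s‖ ≤ v i k := by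
    intro i k s _
    by_cases hik : i < k
    · simp only [hv, if_pos hik]; exact hgeo i k hik s
    · simp only [hv, if_neg hik]; exact hM k i s
  have key := iteratedFDeriv_tsum_apply (𝕜 := ℝ) (N := (⊤ : ℕ∞)) hfs hvs hvb (k := j)
    (by exact_mod_cast le_top) (0 : ℝ)
  -- summability of the `j`-th derivatives at `0`, to evaluate the sum of multilinear maps
  have hsumj : Summable fun k ↦ iteratedFDeriv ℝ j (f k) 0 :=
    .of_norm_bounded (hvs j le_top) fun k ↦ hvb j k 0 le_top
  rw [iteratedDeriv_eq_iteratedFDeriv, show (fun s ↦ ∑' k, cutoffMonomial k (ε k) s * g k s) =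
    fun s ↦ ∑' k, f k s from rfl, key, ContinuousMultilinearMap.tsum_eval hsumj]
  simp_rw [← iteratedDeriv_eq_iteratedFDeriv, hf, iteratedDeriv_cutoffMonomial_mul_zero hε hg]
  rw [tsum_eq_sum (s := range (j + 1)) (fun k hk ↦ by
    rw [if_neg]; simpa [Finset.mem_range, Nat.lt_succ_iff] using hk)]
  refine sum_congr rfl fun k hk ↦ ?_
  rw [if_pos (Nat.lt_succ_iff.1 (Finset.mem_range.1 hk))]

end OneVariable

/-! ### Parameters: smoothness on `E × ℝ` -/

section Param

variable {E : Type*} [NormedAddCommGroup E] [NormedSpace ℝ E]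
  {ε : ℕ → ℝ} {b : ℕ → E → ℝ} {S : ℕ → ℕ → ℝ}

/-- Derivatives of `z ↦ cutoffMonomial k ε z.2` on `E × ℝ` are bounded by those of the cut-off
monomial. [folklore] -/
theorem norm_iteratedFDeriv_cutoffMonomial_snd_le (k : ℕ) (ε' : ℝ) (i : ℕ) (z : E × ℝ) :
    ‖iteratedFDeriv ℝ i (fun z : E × ℝ ↦ cutoffMonomial k ε' z.2) z‖ ≤
      ‖iteratedDeriv i (cutoffMonomial k ε') z.2‖ := by
  have h := ContinuousLinearMap.iteratedFDeriv_comp_right (ContinuousLinearMap.snd ℝ E ℝ)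
    (contDiff_cutoffMonomial k ε') z (i := i) (by exact_mod_cast le_top)
  rw [show (fun z : E × ℝ ↦ cutoffMonomial k ε' z.2) =
    cutoffMonomial k ε' ∘ (ContinuousLinearMap.snd ℝ E ℝ) from rfl, h]
  refine (ContinuousMultilinearMap.norm_compContinuousLinearMap_le _ _).trans ?_
  rw [norm_iteratedFDeriv_eq_norm_iteratedDeriv]
  refine mul_le_of_le_one_right (norm_nonneg _) (prod_le_one (fun _ _ ↦ norm_nonneg _) ?_)
  intro _ _
  exact ContinuousLinearMap.norm_snd_le ℝ E ℝ

/-- Derivatives of `z ↦ b z.1` on `E × ℝ` are bounded by those of `b`. [folklore] -/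
theorem norm_iteratedFDeriv_comp_fst_le {c : E → ℝ} (hc : ContDiff ℝ ∞ c) (i : ℕ) (z : E × ℝ) :
    ‖iteratedFDeriv ℝ i (fun z : E × ℝ ↦ c z.1) z‖ ≤ ‖iteratedFDeriv ℝ i c z.1‖ := by
  have h := ContinuousLinearMap.iteratedFDeriv_comp_right (ContinuousLinearMap.fst ℝ E ℝ)
    hc z (i := i) (by exact_mod_cast le_top)
  rw [show (fun z : E × ℝ ↦ c z.1) = c ∘ (ContinuousLinearMap.fst ℝ E ℝ) from rfl, h]
  refine (ContinuousMultilinearMap.norm_compContinuousLinearMap_le _ _).trans ?_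
  refine mul_le_of_le_one_right (norm_nonneg _) (prod_le_one (fun _ _ ↦ norm_nonneg _) ?_)
  intro _ _
  exact ContinuousLinearMap.norm_fst_le ℝ E ℝ

/-- **Bound for the derivatives of a term with parameters**: for `j < k`, `0 < εₖ ≤ 1`,
`‖Dⁱ bₖ‖ ≤ Sₖᵢ` (`≥ 0`), the `j`-th derivative of `(y, s) ↦ cutoffMonomial k εₖ (s) bₖ(y)` is
bounded by `2ʲ εₖ Cₖ ∑_{i ≤ j} Sₖᵢ` everywhere. [folklore] -/
theorem norm_iteratedFDeriv_cutoffMonomial_mul_param_le {k j : ℕ} (hj : j < k) (hε : 0 < ε k)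
    (hε1 : ε k ≤ 1) (hb : ContDiff ℝ ∞ (b k)) (hS0 : ∀ i, 0 ≤ S k i)
    (hS : ∀ i y, ‖iteratedFDeriv ℝ i (b k) y‖ ≤ S k i) (z : E × ℝ) :
    ‖iteratedFDeriv ℝ j (fun z : E × ℝ ↦ cutoffMonomial k (ε k) z.2 * b k z.1) z‖ ≤
      2 ^ j * (ε k * cutoffConst k) * ∑ i ∈ range (j + 1), S k i := by
  have hf : ContDiff ℝ ∞ (fun z : E × ℝ ↦ cutoffMonomial k (ε k) z.2) :=
    (contDiff_cutoffMonomial k (ε k)).comp contDiff_snd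
  have hg : ContDiff ℝ ∞ (fun z : E × ℝ ↦ b k z.1) := hb.comp contDiff_fst
  refine (norm_iteratedFDeriv_mul_le hf hg z (n := j) (by exact_mod_cast le_top)).trans ?_
  calc ∑ i ∈ range (j + 1), (j.choose i : ℝ) *
        ‖iteratedFDeriv ℝ i (fun z : E × ℝ ↦ cutoffMonomial k (ε k) z.2) z‖ *
        ‖iteratedFDeriv ℝ (j - i) (fun z : E × ℝ ↦ b k z.1) z‖
      ≤ ∑ i ∈ range (j + 1), (j.choose i : ℝ) * (ε k * cutoffConst k) *
        ∑ i' ∈ range (j + 1), S k i' := by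
        refine sum_le_sum fun i hi ↦ ?_
        have hij : i ≤ j := Nat.lt_succ_iff.1 (Finset.mem_range.1 hi)
        refine mul_le_mul (mul_le_mul_of_nonneg_left
          ((norm_iteratedFDeriv_cutoffMonomial_snd_le k (ε k) i z).trans
            (norm_iteratedDeriv_cutoffMonomial_le (hij.trans_lt hj) hε hε1 _))
          (Nat.cast_nonneg _)) ?_ (norm_nonneg _)
          (mul_nonneg (Nat.cast_nonneg _) (mul_nonneg hε.le (cutoffConst_nonneg k)))
        exact ((norm_iteratedFDeriv_comp_fst_le hb (j - i) z).trans (hS (j - i) z.1)).trans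
          (single_le_sum (f := S k) (fun i _ ↦ hS0 i)
            (Finset.mem_range.2 (Nat.lt_succ_of_le (Nat.sub_le j i))))
    _ = 2 ^ j * (ε k * cutoffConst k) * ∑ i ∈ range (j + 1), S k i := by
        rw [← sum_mul, ← sum_mul]
        have := (Nat.cast_inj (R := ℝ)).2 (Nat.sum_range_choose j)
        push_cast at this
        rw [this]

/-- **Smoothness of the cut-off series with parameters.** Let `0 < εₖ ≤ 1`, `bₖ : E → ℝ` smooth
with `‖Dⁱ bₖ‖ ≤ Sₖᵢ` everywhere (`Sₖᵢ ≥ 0`) and `εₖ Cₖ ∑_{i ≤ k} Sₖᵢ ≤ 4⁻ᵏ`. Then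
`(y, s) ↦ ∑ₖ cutoffMonomial k εₖ (s) bₖ(y)` is `C^∞` on `E × ℝ` (Mathlib's
`contDiff_tsum_of_eventually` with the bound `2⁻ᵏ` for the `j`-th derivatives of the terms
`k > j`). [folklore] -/
theorem contDiff_tsum_cutoffMonomial_mul_param (hε : ∀ k, 0 < ε k) (hε1 : ∀ k, ε k ≤ 1)
    (hb : ∀ k, ContDiff ℝ ∞ (b k)) (hS0 : ∀ k i, 0 ≤ S k i)
    (hS : ∀ k i y, ‖iteratedFDeriv ℝ i (b k) y‖ ≤ S k i)
    (hdec : ∀ k, ε k * cutoffConst k * ∑ i ∈ range (k + 1), S k i ≤ (1 / 4) ^ k) :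
    ContDiff ℝ ∞ (fun z : E × ℝ ↦ ∑' k, cutoffMonomial k (ε k) z.2 * b k z.1) := by
  refine contDiff_tsum_of_eventually (N := (⊤ : ℕ∞)) (v := fun _ k ↦ (1 / 2 : ℝ) ^ k)
    (fun k ↦ ((contDiff_cutoffMonomial k (ε k)).comp contDiff_snd).mul ((hb k).comp contDiff_fst))
    (fun j _ ↦ summable_geometric_of_lt_one (by norm_num) (by norm_num)) fun j _ ↦ ?_
  rw [eventually_cofinite]
  refine (finite_le_nat j).subset fun k hk ↦ ?_
  by_contra hjk
  simp only [Set.mem_setOf_eq, not_le] at hjk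
  refine hk fun z ↦ ?_
  refine (norm_iteratedFDeriv_cutoffMonomial_mul_param_le hjk (hε k) (hε1 k) (hb k) (hS0 k)
    (hS k) z).trans ?_
  have hsum : ∑ i ∈ range (j + 1), S k i ≤ ∑ i ∈ range (k + 1), S k i :=
    sum_le_sum_of_subset_of_nonneg (range_subset_range.2 (by omega)) fun i _ _ ↦ hS0 k i
  have hC : 0 ≤ ε k * cutoffConst k := mul_nonneg (hε k).le (cutoffConst_nonneg k)
  calc 2 ^ j * (ε k * cutoffConst k) * ∑ i ∈ range (j + 1), S k i
      ≤ 2 ^ j * (ε k * cutoffConst k * ∑ i ∈ range (k + 1), S k i) := by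
        rw [mul_assoc]; gcongr
    _ ≤ 2 ^ j * (1 / 4) ^ k := by gcongr; exact hdec k
    _ ≤ 2 ^ k * (1 / 4) ^ k :=
        mul_le_mul_of_nonneg_right (pow_le_pow_right₀ (by norm_num) hjk.le) (by positivity)
    _ = (1 / 2) ^ k := by rw [← mul_pow]; norm_num

end Param

/-! ### Borel's lemma with parameters -/

/-- **Borel's lemma with parameters, cut-off series form.** Let `E` be a finite-dimensional real
normed space, `bₖ : E → ℝ` (`k ∈ ℕ`) smooth functions with compact support, and `δₖ > 0` any
prescribed bounds. Then there are scales `0 < εₖ ≤ min(δₖ, 1/2)` such that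
`W(y, s) = ∑ₖ (sᵏ/k!) χ(s/εₖ) bₖ(y)` (the series `∑ₖ cutoffMonomial k εₖ (s) bₖ(y)`) is `C^∞` on
`E × ℝ` and has the prescribed time derivatives on the hyperplane: `∂ₛʲ W(y, 0) = bⱼ(y)` for all
`j` and `y` (É. Borel; Hörmander, Thm. 1.2.6, with the parameter `y`). The scales are
`εₖ = min(δₖ, 1/2, 4⁻ᵏ/(Cₖ ∑_{i ≤ k} sup ‖Dⁱbₖ‖ + 1))`. [folklore] -/
theorem exists_borel_extension {E : Type*} [NormedAddCommGroup E] [NormedSpace ℝ E]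
    [FiniteDimensional ℝ E] (b : ℕ → E → ℝ) (hb : ∀ k, ContDiff ℝ ∞ (b k))
    (hbc : ∀ k, HasCompactSupport (b k)) (δ : ℕ → ℝ) (hδ : ∀ k, 0 < δ k) :
    ∃ ε : ℕ → ℝ, (∀ k, 0 < ε k ∧ ε k ≤ δ k ∧ ε k ≤ 1 / 2) ∧
      ContDiff ℝ ∞ (fun z : E × ℝ ↦ ∑' k, cutoffMonomial k (ε k) z.2 * b k z.1) ∧
      ∀ (y : E) (j : ℕ), iteratedDeriv j (fun s ↦ ∑' k, cutoffMonomial k (ε k) s * b k y) 0 = b j y := by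
  -- global bounds for the derivatives of the coefficients
  have hSex : ∀ k i, ∃ C : ℝ, 0 ≤ C ∧ ∀ y, ‖iteratedFDeriv ℝ i (b k) y‖ ≤ C := by
    intro k i
    obtain ⟨C, hC⟩ := ((hb k).continuous_iteratedFDeriv (by exact_mod_cast le_top)).bounded_above_of_compact_support
      ((hbc k).iteratedFDeriv i)
    exact ⟨max C 0, le_max_right _ _, fun y ↦ (hC y).trans (le_max_left _ _)⟩
  choose S hS0 hS using hSex
  set T : ℕ → ℝ := fun k ↦ ∑ i ∈ range (k + 1), S k i with hT
  have hT0 : ∀ k, 0 ≤ T k := fun k ↦ sum_nonneg fun i _ ↦ hS0 k i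
  -- the scales
  set ε : ℕ → ℝ := fun k ↦ min (δ k) (min (1 / 2) ((1 / 4) ^ k / (cutoffConst k * T k + 1)))
    with hεdef
  have hpos : ∀ k, 0 < cutoffConst k * T k + 1 := fun k ↦
    add_pos_of_nonneg_of_pos (mul_nonneg (cutoffConst_nonneg k) (hT0 k)) one_pos
  have hε : ∀ k, 0 < ε k := fun k ↦ lt_min (hδ k) (lt_min (by norm_num) (div_pos (by positivity) (hpos k)))
  have hεδ : ∀ k, ε k ≤ δ k := fun k ↦ min_le_left _ _
  have hε2 : ∀ k, ε k ≤ 1 / 2 := fun k ↦ (min_le_right _ _).trans (min_le_left _ _)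
  have hε1 : ∀ k, ε k ≤ 1 := fun k ↦ (hε2 k).trans (by norm_num)
  have hdec : ∀ k, ε k * cutoffConst k * ∑ i ∈ range (k + 1), S k i ≤ (1 / 4) ^ k := by
    intro k
    have h1 : ε k ≤ (1 / 4) ^ k / (cutoffConst k * T k + 1) :=
      (min_le_right _ _).trans (min_le_right _ _)
    have hCT : 0 ≤ cutoffConst k * T k := mul_nonneg (cutoffConst_nonneg k) (hT0 k)
    calc ε k * cutoffConst k * ∑ i ∈ range (k + 1), S k i = ε k * (cutoffConst k * T k) := by
          rw [hT]; ring
      _ ≤ (1 / 4) ^ k / (cutoffConst k * T k + 1) * (cutoffConst k * T k) := by gcongr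
      _ ≤ (1 / 4) ^ k := by
          rw [div_mul_eq_mul_div, div_le_iff₀ (hpos k)]
          nlinarith [pow_pos (by norm_num : (0 : ℝ) < 1 / 4) k]
  refine ⟨ε, fun k ↦ ⟨hε k, hεδ k, hε2 k⟩,
    contDiff_tsum_cutoffMonomial_mul_param hε hε1 hb hS0 hS hdec, fun y j ↦ ?_⟩
  -- the time derivatives at `0`: the master lemma with the constant functions `s ↦ bₖ(y)`
  have hL : ∀ k i, ∀ s ∈ Icc (-1 : ℝ) 1, ‖iteratedDeriv i (fun _ : ℝ ↦ b k y) s‖ ≤ S k i := by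
    intro k i s _
    rw [iteratedDeriv_const]
    split_ifs with hi
    · subst hi
      simpa using hS k 0 y
    · simpa using hS0 k i
  have key := iteratedDeriv_tsum_cutoffMonomial_mul_zero (g := fun k (_ : ℝ) ↦ b k y) hε hε2
    (fun k ↦ contDiff_const) hS0 hL hdec j
  rw [key, sum_eq_single j]
  · simp [iteratedDeriv_const]
  · intro k hk hkj
    have hlt : k < j := lt_of_le_of_ne (Nat.lt_succ_iff.1 (Finset.mem_range.1 hk)) hkj
    rw [iteratedDeriv_const, if_neg (by omega), mul_zero]
  · intro h; exact absurd (Finset.mem_range.2 (Nat.lt_succ_self j)) h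

end Literature.Analysis.Calculus

end
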